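import Literature.Analysis.SpecialFunctions.GammaStirlingVertical
import Mathlib.Analysis.SpecialFunctions.JapaneseBracket
import HarnessLib

/-!
# Booker 2003, (17)–(18): vertical integrals against the `Γ`-kernels `(2π)^{-s} Γ(s + k − 1/2)`
# — proofs only

A. R. Booker, *Poles of Artin L-functions and the strong Artin conjecture*, Ann. of Math. 158
(2003), p. 1095: "Now, by Lemma 3 with `n = −1`, we may replace the Γ-factor in (3) by
(17) `Σ_{k=−1}^{m} b_k (2π)^{-s} Γ(s + k − 1/2)` with error terms essentially of the form
(18) `∫ L(s, ρ) e^{i(π/2−δ)s} (2π)^{-s} Γ(s − 3/2) E_{−1}(s) ds`.  Shifting the contour of this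
integral to `Re s = 3/2 + Δ`, with `0 < Δ < 1/2`, the integrand is `O(|s|^{3/2−Δ})^{-1}`,
independently of `δ`, and thus the error is `O(1)` as `δ → 0`."

With the identity (3) available on EVERY line (`Automorphic/BookerStrongArtinContour`,
`Booker2003.integral_eq3_eq_zero`), the line is taken at `c = 3/2 + Δ` from the start, and this
file supplies, for an arbitrary continuous "bracket" `B(t)` on that line with
`‖B(t)‖ ≤ M e^{ϑ|t|}` (for Booker's
`B = L(s)(αe^{iθ})^{1/2−s} − ε(−1)^{m−a} L̄(s)((Nα)^{-1}e^{−iθ})^{1/2−s}`, `θ = π/2 − δ`, one has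
`ϑ = |θ| < π/2`, and `ϑ = π/2` uniformly in `δ`):

* `exists_norm_Gamma_line_le` — `‖Γ(x+it)‖ ≤ C(1+|t|)^{max(x−1/2,0)} e^{−π|t|/2}` for ALL `t`
  (`x > 0`; Stirling for `|t| ≥ 1`, compactness for `|t| ≤ 1`);
* `integrable_mul_twoPi_cpow_mul_Gamma` — the main terms `B(t)(2π)^{-s}Γ(x+it)` of (17)/(19)
  are integrable when `ϑ < π/2`;
* `exists_bound_errorIntegral` — **(18)**: for `3/2 < c < 2` and `‖E(s)‖ ≤ C_E/‖s‖` on the line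
  there is `K` with `‖∫ B(t)(2π)^{-s}Γ(s − 3/2)E(s) dt‖ ≤ K·M` for every continuous `B` with
  `‖B(t)‖ ≤ M e^{(π/2)|t|}` — the error is `O(1)` uniformly as `δ → 0` (sharp Stirling
  `|Γ(Δ+it)| ≪ |t|^{Δ−1/2}e^{−π|t|/2}`, `Analysis/SpecialFunctions/GammaStirlingVertical`, and
  `∫(1+|t|)^{−(3/2−Δ)} dt < ∞`);
* `integral_gammaFactor_eq_sum` — **(17) under the integral sign**: given Lemma 3 on the line
  with `n = −1` (`Booker2003.exists_evenGammaFactor_mul_sub_half_pow_eq_sum`,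
  `Automorphic/BookerStrongArtinLemma3`),
  `∫ B γ_a(s)(s−1/2)^{m−a} dt = Σ_{k=−1}^{m} b_k ∫ B(2π)^{-s}Γ(s+k−1/2) dt + ∫ B(2π)^{-s}Γ(s−3/2)E(s) dt`.

Theorems only; no definitions, no named facts (D-0026).

## References

* A. R. Booker, Ann. of Math. (2) 158 (2003), 1089–1098, p. 1095, (17)–(19). [Booker2003]

## Mathlib / tree search

Tree: `GammaStirling.exists_norm_Gamma_vertical_le` (`GammaStirlingVertical`),
`Literature.Analysis.SpecialFunctions.integrable_one_add_abs_rpow_mul_exp_neg` (`GammaProductBounds`).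
Mathlib: `integrable_one_add_norm` (`JapaneseBracket`), `Complex.differentiableAt_Gamma`,
`Continuous.const_cpow`, `MeasureTheory.integral_finsetSum`, `norm_integral_le_of_norm_le`.
-/

noncomputable section

open Complex Real Set Filter Topology MeasureTheory

namespace Literature.NumberTheory.Automorphic

namespace Booker2003

open Literature.Analysis.SpecialFunctions

/-! ### `Γ` on a vertical line `Re = x > 0`: a bound valid for all heights -/

/-- **`‖Γ(x + it)‖ ≤ C (1 + |t|)^{max(x − 1/2, 0)} e^{−π|t|/2}` for all real `t`** (`x > 0` fixed):
Stirling (`GammaStirling.exists_norm_Gamma_vertical_le`) for `|t| ≥ 1`, continuity of `Γ` on the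
compact segment `|t| ≤ 1`. [folklore] -/
theorem exists_norm_Gamma_line_le {x : ℝ} (hx : 0 < x) :
    ∃ C : ℝ, 0 < C ∧ ∀ t : ℝ, ‖Complex.Gamma ((x : ℂ) + t * I)‖ ≤
      C * (1 + |t|) ^ (max (x - 1 / 2) 0) * Real.exp (-(π * |t|) / 2) := by
  obtain ⟨C₁, hC₁, h₁⟩ := GammaStirling.exists_norm_Gamma_vertical_le x x
  -- the compact part
  have hcont : ContinuousOn (fun t : ℝ ↦ Complex.Gamma ((x : ℂ) + t * I)) (Icc (-1) 1) := by
    refine Continuous.continuousOn ?_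
    have h : ∀ t : ℝ, DifferentiableAt ℂ Complex.Gamma ((x : ℂ) + t * I) := fun t ↦
      Complex.differentiableAt_Gamma _ fun m hm ↦ by
        have := congrArg Complex.re hm
        simp at this
        linarith [Nat.cast_nonneg (α := ℝ) m]
    have hline : Continuous fun t : ℝ ↦ (x : ℂ) + t * I := by fun_prop
    exact continuous_iff_continuousAt.mpr fun t ↦
      ContinuousAt.comp (f := fun t : ℝ ↦ (x : ℂ) + t * I) (h t).continuousAt hline.continuousAt
  obtain ⟨B, hB⟩ := (isCompact_Icc (a := (-1 : ℝ)) (b := 1)).exists_bound_of_continuousOn hcont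
  set B' : ℝ := max B 0 with hB'
  refine ⟨C₁ + B' * Real.exp (π / 2), by positivity, fun t ↦ ?_⟩
  have h1t : (1 : ℝ) ≤ 1 + |t| := by linarith [abs_nonneg t]
  have hpow1 : (1 : ℝ) ≤ (1 + |t|) ^ (max (x - 1 / 2) 0) := Real.one_le_rpow h1t (le_max_right _ _)
  rcases le_or_gt 1 |t| with ht | ht
  · -- Stirling
    have h := h₁ x ⟨le_rfl, le_rfl⟩ t ht
    have ht0 : 0 < |t| := by linarith
    have hp : |t| ^ (x - 1 / 2) ≤ (1 + |t|) ^ (max (x - 1 / 2) 0) :=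
      calc |t| ^ (x - 1 / 2) ≤ |t| ^ (max (x - 1 / 2) 0) :=
            Real.rpow_le_rpow_of_exponent_le ht (le_max_left _ _)
        _ ≤ (1 + |t|) ^ (max (x - 1 / 2) 0) :=
            Real.rpow_le_rpow (abs_nonneg t) (by linarith) (le_max_right _ _)
    calc ‖Complex.Gamma ((x : ℂ) + t * I)‖ ≤ C₁ * |t| ^ (x - 1 / 2) * Real.exp (-(π * |t|) / 2) := h
      _ ≤ C₁ * (1 + |t|) ^ (max (x - 1 / 2) 0) * Real.exp (-(π * |t|) / 2) := by gcongr
      _ ≤ (C₁ + B' * Real.exp (π / 2)) * (1 + |t|) ^ (max (x - 1 / 2) 0) *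
            Real.exp (-(π * |t|) / 2) := by
          gcongr; linarith [show (0 : ℝ) ≤ B' * Real.exp (π / 2) by positivity]
  · -- compactness
    have hmem : t ∈ Icc (-1 : ℝ) 1 := by rw [mem_Icc, ← abs_le]; exact ht.le
    have hΓ : ‖Complex.Gamma ((x : ℂ) + t * I)‖ ≤ B' := (hB t hmem).trans (le_max_left _ _)
    have hexp : (1 : ℝ) ≤ Real.exp (π / 2) * Real.exp (-(π * |t|) / 2) := by
      rw [← Real.exp_add]
      exact Real.one_le_exp (by nlinarith [Real.pi_pos, abs_nonneg t])
    calc ‖Complex.Gamma ((x : ℂ) + t * I)‖ ≤ B' := hΓ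
      _ ≤ B' * ((1 + |t|) ^ (max (x - 1 / 2) 0) * (Real.exp (π / 2) * Real.exp (-(π * |t|) / 2))) :=
          le_mul_of_one_le_right (le_max_right _ _) (one_le_mul_of_one_le_of_one_le hpow1 hexp)
      _ = (B' * Real.exp (π / 2)) * (1 + |t|) ^ (max (x - 1 / 2) 0) * Real.exp (-(π * |t|) / 2) := by
          ring
      _ ≤ (C₁ + B' * Real.exp (π / 2)) * (1 + |t|) ^ (max (x - 1 / 2) 0) *
            Real.exp (-(π * |t|) / 2) := by
          gcongr; linarith


/-- `‖(2π)^{-(c + it)}‖ = (2π)^{-c}`. [folklore] -/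
theorem norm_twoPi_cpow_neg (c t : ℝ) :
    ‖(2 * π : ℂ) ^ (-((c : ℂ) + t * I))‖ = (2 * π) ^ (-c) := by
  have h2π : (0 : ℝ) < 2 * π := by positivity
  rw [show (2 * π : ℂ) = ((2 * π : ℝ) : ℂ) by push_cast; ring,
    Complex.norm_cpow_eq_rpow_re_of_pos h2π]
  congr 1; simp

/-- Continuity of `t ↦ (2π)^{-(c+it)}`. [folklore] -/
theorem continuous_twoPi_cpow_neg (c : ℝ) :
    Continuous fun t : ℝ ↦ (2 * π : ℂ) ^ (-((c : ℂ) + t * I)) := by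
  refine Continuous.const_cpow (by fun_prop) (Or.inl ?_)
  have : (0 : ℝ) < 2 * π := by positivity
  exact_mod_cast this.ne'

/-- Continuity of `t ↦ Γ(x + it)` for `x > 0`. [folklore] -/
theorem continuous_Gamma_line {x : ℝ} (hx : 0 < x) :
    Continuous fun t : ℝ ↦ Complex.Gamma ((x : ℂ) + t * I) := by
  have h : ∀ t : ℝ, DifferentiableAt ℂ Complex.Gamma ((x : ℂ) + t * I) := fun t ↦
    Complex.differentiableAt_Gamma _ fun m hm ↦ by
      have := congrArg Complex.re hm
      simp at this
      linarith [Nat.cast_nonneg (α := ℝ) m]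
  have hline : Continuous fun t : ℝ ↦ (x : ℂ) + t * I := by fun_prop
  exact continuous_iff_continuousAt.mpr fun t ↦
    ContinuousAt.comp (f := fun t : ℝ ↦ (x : ℂ) + t * I) (h t).continuousAt hline.continuousAt

/-! ### The main terms: integrability against `(2π)^{-s} Γ(x + it)` for `|θ| < π/2` -/

/-- **Integrability of the main terms of (19).** If `B : ℝ → ℂ` is continuous with
`‖B(t)‖ ≤ M e^{ϑ|t|}` for some `ϑ < π/2` (the bracket
`L(s)(αe^{iθ})^{1/2−s} − ε(−1)^{m−a}L̄(s)((Nα)^{-1}e^{−iθ})^{1/2−s}` on `Re s = c`, `|θ| ≤ ϑ`), then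
`t ↦ B(t) (2π)^{-(c+it)} Γ(x + it)` is integrable for every `x > 0` (the kernels
`(2π)^{-s}Γ(s + k − 1/2)` of (17), `x = c + k − 1/2`). [cite: Booker2003, p. 1095, (17)–(19)] -/
theorem integrable_mul_twoPi_cpow_mul_Gamma {B : ℝ → ℂ} (hB : Continuous B) {M ϑ : ℝ}
    (hϑ : ϑ < π / 2) (hBle : ∀ t : ℝ, ‖B t‖ ≤ M * Real.exp (ϑ * |t|)) (c : ℝ) {x : ℝ} (hx : 0 < x) :
    Integrable fun t : ℝ ↦ B t * (2 * π : ℂ) ^ (-((c : ℂ) + t * I)) * Complex.Gamma ((x : ℂ) + t * I) := by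
  obtain ⟨C, hC, hΓ⟩ := exists_norm_Gamma_line_le hx
  have hM : 0 ≤ M := by
    have h := (norm_nonneg _).trans (hBle 0)
    simpa using h
  set p : ℝ := max (x - 1 / 2) 0 with hp
  set κ : ℝ := π / 2 - ϑ with hκ
  have hκ0 : 0 < κ := by rw [hκ]; linarith
  have hcont : Continuous fun t : ℝ ↦ B t * (2 * π : ℂ) ^ (-((c : ℂ) + t * I)) *
      Complex.Gamma ((x : ℂ) + t * I) :=
    (hB.mul (continuous_twoPi_cpow_neg c)).mul (continuous_Gamma_line hx)
  have hmaj : Integrable fun t : ℝ ↦ M * (2 * π) ^ (-c) * C * ((1 + |t|) ^ p * Real.exp (-(κ * |t|))) :=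
    (integrable_one_add_abs_rpow_mul_exp_neg hκ0 (le_max_right _ _)).const_mul _
  refine hmaj.mono' hcont.aestronglyMeasurable (Eventually.of_forall fun t ↦ ?_)
  rw [norm_mul, norm_mul, norm_twoPi_cpow_neg]
  have hexp : Real.exp (ϑ * |t|) * Real.exp (-(π * |t|) / 2) = Real.exp (-(κ * |t|)) := by
    rw [← Real.exp_add]; congr 1; rw [hκ]; ring
  calc ‖B t‖ * (2 * π) ^ (-c) * ‖Complex.Gamma ((x : ℂ) + t * I)‖
      ≤ (M * Real.exp (ϑ * |t|)) * (2 * π) ^ (-c) * (C * (1 + |t|) ^ p * Real.exp (-(π * |t|) / 2)) :=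
        mul_le_mul (mul_le_mul_of_nonneg_right (hBle t) (by positivity)) (hΓ t) (norm_nonneg _)
          (by positivity)
    _ = M * (2 * π) ^ (-c) * C * ((1 + |t|) ^ p * (Real.exp (ϑ * |t|) * Real.exp (-(π * |t|) / 2))) := by
        ring
    _ = _ := by rw [hexp]

/-! ### The error term (18): integrable, and bounded uniformly in `θ` -/

/-- **Booker 2003, (18): the error term is `O(1)` as `δ → 0`.** On the line `Re s = c`,
`c = 3/2 + Δ` with `0 < Δ < 1/2`, let `E` be the error function of Lemma 3 (`‖E(s)‖ ≤ C_E/‖s‖`,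
continuous along the line). There is `K` such that for every continuous `B : ℝ → ℂ` with
`‖B(t)‖ ≤ M e^{(π/2)|t|}` — any bracket `L(s)(αe^{iθ})^{1/2−s} − …` with `|θ| ≤ π/2`, `L`
bounded on the line, uniformly in `θ` — the integral `∫ B(t) (2π)^{-s} Γ(s − 3/2) E(s) dt`
(`s = c + it`) converges absolutely and has norm `≤ K M`: "the integrand is
`O(|s|^{3/2−Δ})^{-1}`, independently of `δ`, and thus the error is `O(1)` as `δ → 0`" (sharp
Stirling `|Γ(Δ + it)| ≪ |t|^{Δ−1/2}e^{−π|t|/2}`, `GammaStirling.exists_norm_Gamma_vertical_le`).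
[cite: Booker2003, p. 1095, (18)] -/
theorem exists_bound_errorIntegral {c : ℝ} (hc1 : 3 / 2 < c) (hc2 : c < 2) {E : ℂ → ℂ} {CE : ℝ}
    (hEc : Continuous fun t : ℝ ↦ E ((c : ℂ) + t * I))
    (hE : ∀ t : ℝ, ‖E ((c : ℂ) + t * I)‖ ≤ CE / ‖(c : ℂ) + t * I‖) :
    ∃ K : ℝ, 0 ≤ K ∧ ∀ (B : ℝ → ℂ) (M : ℝ), Continuous B →
      (∀ t : ℝ, ‖B t‖ ≤ M * Real.exp (π / 2 * |t|)) →
      Integrable (fun t : ℝ ↦ B t * (2 * π : ℂ) ^ (-((c : ℂ) + t * I)) *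
        Complex.Gamma (((c : ℂ) + t * I) - 3 / 2) * E ((c : ℂ) + t * I)) ∧
      ‖∫ t : ℝ, B t * (2 * π : ℂ) ^ (-((c : ℂ) + t * I)) *
          Complex.Gamma (((c : ℂ) + t * I) - 3 / 2) * E ((c : ℂ) + t * I)‖ ≤ K * M := by
  set Δ : ℝ := c - 3 / 2 with hΔ
  have hΔ0 : 0 < Δ := by rw [hΔ]; linarith
  have hΔ1 : Δ < 1 / 2 := by rw [hΔ]; linarith
  have hc0 : 0 < c := by linarith
  have hCE : 0 ≤ CE := by
    have h := (norm_nonneg _).trans (hE 0)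
    have hn : 0 < ‖(c : ℂ) + (0 : ℝ) * I‖ := by simp [abs_of_pos hc0, hc0]
    exact (div_nonneg_iff.mp ((norm_nonneg _).trans (hE 0))).elim (fun h ↦ h.1)
      (fun h ↦ absurd h.2 (not_le.mpr hn))
  -- the Γ-kernel on the line `Re = Δ`
  have harg : ∀ t : ℝ, ((c : ℂ) + t * I) - 3 / 2 = ((Δ : ℝ) : ℂ) + t * I := by
    intro t; rw [hΔ]; push_cast; ring
  obtain ⟨C₁, hC₁, hSt⟩ := GammaStirling.exists_norm_Gamma_vertical_le Δ Δ
  obtain ⟨C₀, hC₀, hK0⟩ := exists_norm_Gamma_line_le hΔ0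
  -- the dominating function `(1 + |t|)^{-r}`, `r = 3/2 − Δ > 1`
  set r : ℝ := 3 / 2 - Δ with hr
  have hr1 : 1 < r := by rw [hr]; linarith
  have hJint : Integrable fun t : ℝ ↦ (1 + ‖t‖) ^ (-r) :=
    integrable_one_add_norm (by simpa using hr1)
  set J : ℝ := ∫ t : ℝ, (1 + ‖t‖) ^ (-r) with hJ
  have hJ0 : 0 ≤ J := integral_nonneg fun t ↦ by positivity
  -- the constant
  set K₂ : ℝ := (2 * π) ^ (-c) * CE * (2 : ℝ) ^ r * (C₁ + Real.exp (π / 2) * C₀ / c) with hK₂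
  have hK₂0 : 0 ≤ K₂ := by positivity
  refine ⟨K₂ * J, by positivity, fun B M hB hBle ↦ ?_⟩
  have hM : 0 ≤ M := by
    have h := (norm_nonneg _).trans (hBle 0)
    simpa using h
  -- pointwise domination
  have hdom : ∀ t : ℝ, ‖B t * (2 * π : ℂ) ^ (-((c : ℂ) + t * I)) *
      Complex.Gamma (((c : ℂ) + t * I) - 3 / 2) * E ((c : ℂ) + t * I)‖ ≤
      M * K₂ * (1 + ‖t‖) ^ (-r) := by
    intro t
    rw [norm_mul, norm_mul, norm_mul, norm_twoPi_cpow_neg, harg t, Real.norm_eq_abs]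
    have h1t : (1 : ℝ) ≤ 1 + |t| := by linarith [abs_nonneg t]
    have hs : c ≤ ‖(c : ℂ) + t * I‖ := by
      have h := Complex.re_le_norm ((c : ℂ) + t * I)
      simpa using h
    have hsn : |t| ≤ ‖(c : ℂ) + t * I‖ := by
      have h := Complex.abs_im_le_norm ((c : ℂ) + t * I)
      simpa using h
    have hs0 : 0 < ‖(c : ℂ) + t * I‖ := hc0.trans_le hs
    -- `(1+|t|)^{-r} ≥ 2^{-r} max(1,|t|)^{-r}`
    rcases le_or_gt 1 |t| with ht | ht
    · -- `|t| ≥ 1`: Stirling and `‖E‖ ≤ C_E/|t|`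
      have ht0 : 0 < |t| := by linarith
      have hΓ := hSt Δ ⟨le_rfl, le_rfl⟩ t ht
      have hEt : ‖E ((c : ℂ) + t * I)‖ ≤ CE / |t| :=
        (hE t).trans (div_le_div_of_nonneg_left hCE ht0 hsn)
      have hB' : ‖B t‖ ≤ M * Real.exp (π / 2 * |t|) := hBle t
      have hexp : Real.exp (π / 2 * |t|) * Real.exp (-(π * |t|) / 2) = 1 := by
        rw [← Real.exp_add]; convert Real.exp_zero using 2; ring
      -- `|t|^{Δ − 1/2} / |t| = |t|^{-r} ≤ 2^r (1+|t|)^{-r}`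
      have hpow : |t| ^ (Δ - 1 / 2) / |t| ≤ (2 : ℝ) ^ r * (1 + |t|) ^ (-r) := by
        have h1 : |t| ^ (Δ - 1 / 2) / |t| = |t| ^ (-r) := by
          rw [hr, div_eq_mul_inv, ← Real.rpow_neg_one, ← Real.rpow_add ht0]; congr 1; ring
        rw [h1]
        have h2 : (1 + |t|) ^ (-r) = ((1 + |t|)⁻¹) ^ r := by
          rw [Real.rpow_neg (by positivity), Real.inv_rpow (by positivity)]
        have h3 : |t| ^ (-r) = (|t|⁻¹) ^ r := by
          rw [Real.rpow_neg ht0.le, Real.inv_rpow ht0.le]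
        rw [h2, h3, ← Real.mul_rpow (by norm_num) (by positivity)]
        refine Real.rpow_le_rpow (by positivity) ?_ (by linarith)
        rw [inv_eq_one_div, inv_eq_one_div, mul_one_div, div_le_div_iff₀ ht0 (by positivity)]
        linarith
      calc ‖B t‖ * (2 * π) ^ (-c) * ‖Complex.Gamma ((Δ : ℂ) + t * I)‖ * ‖E ((c : ℂ) + t * I)‖
          ≤ (M * Real.exp (π / 2 * |t|)) * (2 * π) ^ (-c) *
              (C₁ * |t| ^ (Δ - 1 / 2) * Real.exp (-(π * |t|) / 2)) * (CE / |t|) :=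
            mul_le_mul (mul_le_mul (mul_le_mul_of_nonneg_right hB' (by positivity)) hΓ
              (norm_nonneg _) (by positivity)) hEt (norm_nonneg _) (by positivity)
        _ = M * (2 * π) ^ (-c) * CE * C₁ * (|t| ^ (Δ - 1 / 2) / |t|) *
              (Real.exp (π / 2 * |t|) * Real.exp (-(π * |t|) / 2)) := by
            field_simp
        _ = M * (2 * π) ^ (-c) * CE * C₁ * (|t| ^ (Δ - 1 / 2) / |t|) := by rw [hexp, mul_one]
        _ ≤ M * (2 * π) ^ (-c) * CE * C₁ * ((2 : ℝ) ^ r * (1 + |t|) ^ (-r)) :=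
            mul_le_mul_of_nonneg_left hpow (by positivity)
        _ ≤ M * K₂ * (1 + |t|) ^ (-r) := by
            rw [hK₂]
            have h0 : (0 : ℝ) ≤ Real.exp (π / 2) * C₀ / c := by positivity
            have hX : (0 : ℝ) ≤ M * (2 * π) ^ (-c) * CE * (2 : ℝ) ^ r * (1 + |t|) ^ (-r) := by
              positivity
            nlinarith
    · -- `|t| < 1`: everything is bounded
      have hΓ : ‖Complex.Gamma ((Δ : ℂ) + t * I)‖ ≤ C₀ * Real.exp (-(π * |t|) / 2) := by
        have h := hK0 t
        have hmax : max (Δ - 1 / 2) 0 = 0 := max_eq_right (by linarith)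
        rw [hmax, Real.rpow_zero, mul_one] at h
        exact h
      have hEt : ‖E ((c : ℂ) + t * I)‖ ≤ CE / c := (hE t).trans (div_le_div_of_nonneg_left hCE hc0 hs)
      have hB' : ‖B t‖ ≤ M * Real.exp (π / 2) := by
        refine (hBle t).trans (mul_le_mul_of_nonneg_left (Real.exp_le_exp.mpr ?_) hM)
        nlinarith [Real.pi_pos, abs_nonneg t]
      have hpow : (1 : ℝ) ≤ (2 : ℝ) ^ r * (1 + |t|) ^ (-r) := by
        have h2 : (1 + |t|) ^ (-r) = ((1 + |t|)⁻¹) ^ r := by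
          rw [Real.rpow_neg (by positivity), Real.inv_rpow (by positivity)]
        rw [h2, ← Real.mul_rpow (by norm_num) (by positivity)]
        refine Real.one_le_rpow ?_ (by linarith)
        rw [le_mul_inv_iff₀ (by positivity)]; linarith
      have hexp1 : Real.exp (-(π * |t|) / 2) ≤ 1 := by
        rw [Real.exp_le_one_iff]; nlinarith [Real.pi_pos, abs_nonneg t]
      calc ‖B t‖ * (2 * π) ^ (-c) * ‖Complex.Gamma ((Δ : ℂ) + t * I)‖ * ‖E ((c : ℂ) + t * I)‖
          ≤ (M * Real.exp (π / 2)) * (2 * π) ^ (-c) * (C₀ * Real.exp (-(π * |t|) / 2)) * (CE / c) :=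
            mul_le_mul (mul_le_mul (mul_le_mul_of_nonneg_right hB' (by positivity)) hΓ
              (norm_nonneg _) (by positivity)) hEt (norm_nonneg _) (by positivity)
        _ ≤ (M * Real.exp (π / 2)) * (2 * π) ^ (-c) * (C₀ * 1) * (CE / c) := by gcongr
        _ = M * ((2 * π) ^ (-c) * CE * (Real.exp (π / 2) * C₀ / c)) * 1 := by
            field_simp
        _ ≤ M * ((2 * π) ^ (-c) * CE * (Real.exp (π / 2) * C₀ / c)) *
              ((2 : ℝ) ^ r * (1 + |t|) ^ (-r)) :=
            mul_le_mul_of_nonneg_left hpow (by positivity)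
        _ ≤ M * K₂ * (1 + |t|) ^ (-r) := by
            rw [hK₂]
            have hX : (0 : ℝ) ≤ M * (2 * π) ^ (-c) * CE * (2 : ℝ) ^ r * (1 + |t|) ^ (-r) := by
              positivity
            nlinarith
  have hcont : Continuous fun t : ℝ ↦ B t * (2 * π : ℂ) ^ (-((c : ℂ) + t * I)) *
      Complex.Gamma (((c : ℂ) + t * I) - 3 / 2) * E ((c : ℂ) + t * I) := by
    have hΓc : Continuous fun t : ℝ ↦ Complex.Gamma (((c : ℂ) + t * I) - 3 / 2) := by
      simp_rw [harg]; exact continuous_Gamma_line hΔ0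
    exact ((hB.mul (continuous_twoPi_cpow_neg c)).mul hΓc).mul hEc
  have hint : Integrable fun t : ℝ ↦ B t * (2 * π : ℂ) ^ (-((c : ℂ) + t * I)) *
      Complex.Gamma (((c : ℂ) + t * I) - 3 / 2) * E ((c : ℂ) + t * I) :=
    (hJint.const_mul (M * K₂)).mono' hcont.aestronglyMeasurable (Eventually.of_forall hdom)
  refine ⟨hint, ?_⟩
  calc ‖∫ t : ℝ, B t * (2 * π : ℂ) ^ (-((c : ℂ) + t * I)) *
          Complex.Gamma (((c : ℂ) + t * I) - 3 / 2) * E ((c : ℂ) + t * I)‖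
      ≤ ∫ t : ℝ, M * K₂ * (1 + ‖t‖) ^ (-r) :=
        norm_integral_le_of_norm_le (hJint.const_mul (M * K₂)) (Eventually.of_forall hdom)
    _ = K₂ * J * M := by rw [integral_const_mul, hJ]; ring


/-! ### (17): inserting Lemma 3 under the integral sign -/

/-- The shifted kernel on the line: `Γ((c + it) + k − 1/2) = Γ((c + k − 1/2) + it)`. [folklore] -/
theorem Gamma_line_shift (c t : ℝ) (k : ℤ) :
    Complex.Gamma (((c : ℂ) + t * I) + k - 1 / 2) = Complex.Gamma ((((c + k - 1 / 2 : ℝ)) : ℂ) + t * I) := by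
  congr 1; push_cast; ring

/-- **Booker 2003, (17) under the integral.** Let `B : ℝ → ℂ` be continuous with
`‖B(t)‖ ≤ M e^{ϑ|t|}`, `ϑ < π/2`, on the line `Re s = c`, `3/2 < c < 2`, and let Lemma 3 hold
there with `n = −1`:
`π^{-s}Γ((s+a)/2)²(s − 1/2)^{m−a} = Σ_{k=−1}^{m} b_k (2π)^{-s}Γ(s + k − 1/2) + (2π)^{-s}Γ(s − 3/2)E(s)`
(`Booker2003.exists_evenGammaFactor_mul_sub_half_pow_eq_sum`, file `BookerStrongArtinLemma3`),
`E` continuous along the line with `‖E(s)‖ ≤ C_E/‖s‖`. Then the `Γ`-factor may be replaced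
under the integral sign:
`∫ B γ_a(s)(s−1/2)^{m−a} dt = Σ_{k=−1}^{m} b_k ∫ B (2π)^{-s}Γ(s+k−1/2) dt + ∫ B (2π)^{-s}Γ(s−3/2)E(s) dt`,
all integrals converging absolutely. [cite: Booker2003, p. 1095, (17)–(18)] -/
theorem integral_gammaFactor_eq_sum {B : ℝ → ℂ} (hB : Continuous B) {M ϑ : ℝ} (hϑ : ϑ < π / 2)
    (hBle : ∀ t : ℝ, ‖B t‖ ≤ M * Real.exp (ϑ * |t|)) {c : ℝ} (hc1 : 3 / 2 < c) (hc2 : c < 2)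
    {a m : ℕ} {b : ℤ → ℝ} {E : ℂ → ℂ} {CE : ℝ} (hEc : Continuous fun t : ℝ ↦ E ((c : ℂ) + t * I))
    (hE : ∀ t : ℝ, ‖E ((c : ℂ) + t * I)‖ ≤ CE / ‖(c : ℂ) + t * I‖)
    (hL3 : ∀ t : ℝ,
      (π : ℂ) ^ (-((c : ℂ) + t * I)) * Complex.Gamma ((((c : ℂ) + t * I) + a) / 2) ^ 2 *
          (((c : ℂ) + t * I) - 1 / 2) ^ (m - a) =
        ∑ k ∈ Finset.Icc (-1 : ℤ) m,
            (b k : ℂ) * ((2 * π : ℂ) ^ (-((c : ℂ) + t * I)) * Complex.Gamma (((c : ℂ) + t * I) + k - 1 / 2)) +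
          (2 * π : ℂ) ^ (-((c : ℂ) + t * I)) * Complex.Gamma (((c : ℂ) + t * I) + ((-1 : ℤ) : ℂ) - 1 / 2) *
            E ((c : ℂ) + t * I)) :
    (∀ k : ℤ, -1 ≤ k → Integrable fun t : ℝ ↦
        B t * (2 * π : ℂ) ^ (-((c : ℂ) + t * I)) * Complex.Gamma (((c : ℂ) + t * I) + k - 1 / 2)) ∧
    Integrable (fun t : ℝ ↦ B t * (2 * π : ℂ) ^ (-((c : ℂ) + t * I)) *
        Complex.Gamma (((c : ℂ) + t * I) - 3 / 2) * E ((c : ℂ) + t * I)) ∧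
    ∫ t : ℝ, B t * ((π : ℂ) ^ (-((c : ℂ) + t * I)) * Complex.Gamma ((((c : ℂ) + t * I) + a) / 2) ^ 2 *
        (((c : ℂ) + t * I) - 1 / 2) ^ (m - a)) =
      ∑ k ∈ Finset.Icc (-1 : ℤ) m, (b k : ℂ) *
          (∫ t : ℝ, B t * (2 * π : ℂ) ^ (-((c : ℂ) + t * I)) * Complex.Gamma (((c : ℂ) + t * I) + k - 1 / 2)) +
        (∫ t : ℝ, B t * (2 * π : ℂ) ^ (-((c : ℂ) + t * I)) *
          Complex.Gamma (((c : ℂ) + t * I) - 3 / 2) * E ((c : ℂ) + t * I)) := by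
  -- integrability of the main terms
  have hmain : ∀ k : ℤ, -1 ≤ k → Integrable fun t : ℝ ↦
      B t * (2 * π : ℂ) ^ (-((c : ℂ) + t * I)) * Complex.Gamma (((c : ℂ) + t * I) + k - 1 / 2) := by
    intro k hk
    have hx : 0 < c + k - 1 / 2 := by
      have : (-1 : ℝ) ≤ k := by exact_mod_cast hk
      linarith
    have h := integrable_mul_twoPi_cpow_mul_Gamma hB hϑ hBle c hx
    refine h.congr (Eventually.of_forall fun t ↦ ?_)
    simp only [Gamma_line_shift]
  -- integrability of the error term
  have hBle' : ∀ t : ℝ, ‖B t‖ ≤ max M 0 * Real.exp (π / 2 * |t|) := fun t ↦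
    (hBle t).trans (mul_le_mul (le_max_left _ _) (Real.exp_le_exp.mpr
      (mul_le_mul_of_nonneg_right hϑ.le (abs_nonneg t))) (Real.exp_pos _).le (le_max_right _ _))
  obtain ⟨K, -, hK⟩ := exists_bound_errorIntegral hc1 hc2 hEc hE
  have herr := (hK B (max M 0) hB hBle').1
  refine ⟨hmain, herr, ?_⟩
  -- pointwise identity, then linearity of the integral
  have hpt : ∀ t : ℝ, B t * ((π : ℂ) ^ (-((c : ℂ) + t * I)) *
      Complex.Gamma ((((c : ℂ) + t * I) + a) / 2) ^ 2 * (((c : ℂ) + t * I) - 1 / 2) ^ (m - a)) =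
      ∑ k ∈ Finset.Icc (-1 : ℤ) m, (b k : ℂ) *
          (B t * (2 * π : ℂ) ^ (-((c : ℂ) + t * I)) * Complex.Gamma (((c : ℂ) + t * I) + k - 1 / 2)) +
        B t * (2 * π : ℂ) ^ (-((c : ℂ) + t * I)) *
          Complex.Gamma (((c : ℂ) + t * I) - 3 / 2) * E ((c : ℂ) + t * I) := by
    intro t
    rw [hL3 t, mul_add, Finset.mul_sum]
    congr 1
    · refine Finset.sum_congr rfl fun k _ ↦ ?_
      ring
    · have : ((c : ℂ) + t * I) + ((-1 : ℤ) : ℂ) - 1 / 2 = ((c : ℂ) + t * I) - 3 / 2 := by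
        push_cast; ring
      rw [this]; ring
  simp_rw [hpt]
  have hmain' : ∀ k ∈ Finset.Icc (-1 : ℤ) m, Integrable (fun t : ℝ ↦ (b k : ℂ) *
      (B t * (2 * π : ℂ) ^ (-((c : ℂ) + t * I)) * Complex.Gamma (((c : ℂ) + t * I) + k - 1 / 2)))
      (volume : Measure ℝ) :=
    fun k hk ↦ (hmain k (Finset.mem_Icc.mp hk).1).const_mul _
  have hsumint : Integrable (fun t : ℝ ↦ ∑ k ∈ Finset.Icc (-1 : ℤ) m, (b k : ℂ) *
      (B t * (2 * π : ℂ) ^ (-((c : ℂ) + t * I)) * Complex.Gamma (((c : ℂ) + t * I) + k - 1 / 2)))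
      (volume : Measure ℝ) :=
    integrable_finsetSum _ hmain'
  rw [integral_add hsumint herr, integral_finsetSum _ hmain']
  simp_rw [integral_const_mul]

end Booker2003

end Literature.NumberTheory.Automorphic

end
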